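import Mathlib
import Literature.NumberTheory.Automorphic.LegendrePQuadraticTransformation
import HarnessLib

/-!
# `∫₁^∞ Δ(it)/E₄(it)² dt = (1728π)⁻¹ ∫₀¹ P_{−1/6}(ξ)² dξ`: the Legendre-square period of `Δ/E₄²` (proved)

Zhou, *Kontsevich–Zagier integrals for automorphic Green's functions. I* (2015), Remark 9 (arXiv p. 19)
evaluates `G₂^{ℌ/PSL₂(ℤ)}(ρ, i) = −(8π/3)∫₀¹ P_{−1/6}(ξ)² dξ` by inserting `z = ρ` (`α₁ = ∞`) and `z' = i`
(`α₁ = ½`, `ξ = 0`) into the integral representation (G2_z_z'_arb), whose integration variable is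
`ξ = √((j(ζ) − 1728)/j(ζ))` along the path from `z' = i` to `i∞`, with `[P_{−1/6}(ξ)]¹² = Δj = E₄³`
(eq. (P_sixth_eta)) and `ζ = iP_{−1/6}(−ξ)/P_{−1/6}(ξ)` (eq. (z_Pnu_ratios)). On the half-axis `ζ = it`,
`t > 1`, this substitution is elementary and is PROVED here for the weight-4 meromorphic form `Δ/E₄²`
(the `ζ`-integrand of Zhou's Theorem 1.2.1(c) at `z = ρ`, where `ρ₂(ζ, ρ)` is constant):

* `axisXi t = E₆(it)E₄(it)^{−3/2}` (`= √(1 − T)`, `T = 1728/j(it)`), increasing from `0` (`t = 1`,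
  `E₆(i) = 0`) to `1` (`t → ∞`), with `ξ' = π√E₄·(1 − ξ²)` (`hasDerivAt_axisXi`, Ramanujan's system);
* `√E₄(it) = P_{−1/6}(ξ(t))²` (`sqrt_e₄_eq_legendreP_sq`): the Fricke–Klein identity
  `E₄^{1/4} = ₂F₁(1/12,5/12;1;T)` of `EisensteinE4Hypergeometric.lean` and Gauss's quadratic
  transformation `P_{−1/6}(ξ) = ₂F₁(1/12,5/12;1;1−ξ²)` of `LegendrePQuadraticTransformation.lean`;
* hence `Δ/E₄²(it) = E₄T/1728 = P_{−1/6}(ξ)² ξ'/(1728π)` and, by the one-dimensional change of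
  variables, **`∫₁^∞ Δ(it)/E₄(it)² dt = (1728π)⁻¹ ∫₀¹ P_{−1/6}(ξ)² dξ = (1728π)⁻¹(3√3/(2π)) log(2+√3)`**
  (`integral_deltaOverE4Sq_axis`, `_eq_log`, complex form `integral_discriminant_div_E₄_sq_axis`),
  the closed form being conjunct (ii)b of the tree's `Zhou2015_legendreP_sq_integral`
  (`integral_legendreP_neg_one_sixth_sq`).

This is the evaluation input for conjunct (ii)a of that named fact (`higherGreen 1 2 1 ρ i =
−(16π/3)∫₀¹P_{−1/6}²`) along the uniqueness route (`resolventGreen_unique_holds`,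
`higherGreen_isResolventGreenLike_holds`): what remains is the Eichler-integral representation of
`w ↦ G₂(ρ, w)` by `Δ/E₄²` and its value `2C∫₁^∞ Δ(it)/E₄(it)² dt` at `w = i`.

## References

* [Zhou2015] Y. Zhou, Ramanujan J. 38 (2015), arXiv:1312.6352: Remark 9 (p. 19), Prop. 2.2.2 with
  eqs. (P_sixth_eta), (z_Pnu_ratios), (Pnu_ratio_deriv) (pp. 17–18), Theorem 1.2.1(c) (p. 5).
* [Zagier2008] D. Zagier, in *The 1-2-3 of Modular Forms*, §5.4 eq. (74) (Fricke–Klein).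
* [AndrewsAskeyRoy1999] §3.1 (3.1.3) (Gauss's quadratic transformation).
* [DhokerKaidi2024] (8.2.7) (`(2πi)⁻¹dj/dτ = −(E₆/E₄)j`).
-/

noncomputable section

open Real Filter Set ModularForm EisensteinSeries
open scoped Topology

namespace Literature.NumberTheory.ModularForms

open Literature.NumberTheory.Automorphic (legendreP legendreP_one)
open Literature.NumberTheory.Automorphic.LegendreP
open Literature.NumberTheory.EllipticCurves.ModularForms (axisPt coe_axisPt)
open MeasureTheory

/-! ## The substitution `ξ = E₆/E₄^{3/2}` on the half-axis and `∫₁^∞ Δ(it)/E₄(it)² dt` -/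

/-- `ξ(t) := E₆(it)·E₄(it)^{−3/2} = √(1 − 1728/j(it))`, Zhou's `√((j − 1728)/j)` restricted to the half-axis
`t > 1` (where `E₆(it) > 0`). [cite: Zhou2015, Remark 9 and eq. (P_sixth_eta), (z_Pnu_ratios) (arXiv pp. 17–19)] -/
def axisXi (t : ℝ) : ℝ := e₆ t * e₄ t ^ (-(3 / 2 : ℝ))

/-- `ξ² = 1 − T`, `T = 1728/j = 1 − E₆²/E₄³`. [folklore] -/
theorem axisXi_sq {t : ℝ} (ht : 0 < t) : axisXi t ^ 2 = 1 - axisT t := by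
  have h4 := e₄_pos ht
  have hp : (e₄ t ^ (-(3 / 2 : ℝ))) ^ 2 = (e₄ t ^ 3)⁻¹ := by
    rw [← Real.rpow_natCast, ← Real.rpow_mul h4.le]
    norm_num
    rfl
  rw [axisXi, one_sub_axisT, mul_pow, hp, div_eq_mul_inv]

/-- `ξ(t) > 0` for `t > 1`. [folklore] -/
theorem axisXi_pos {t : ℝ} (ht : 1 < t) : 0 < axisXi t :=
  mul_pos (e₆_pos ht) (Real.rpow_pos_of_pos (e₄_pos (zero_lt_one.trans ht)) _)

/-- `ξ(t) < 1` for `t > 1`. [folklore] -/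
theorem axisXi_lt_one {t : ℝ} (ht : 1 < t) : axisXi t < 1 := by
  have h := axisXi_sq (zero_lt_one.trans ht)
  have hT := axisT_pos ht
  have hx := axisXi_pos ht
  nlinarith

/-- `ξ(1) = 0` (`E₆(i) = 0`). [folklore] -/
theorem axisXi_one : axisXi 1 = 0 := by
  rw [axisXi, e₆_one, zero_mul]

/-- **`ξ' = π √E₄ · T = π √E₄ (1 − ξ²)`** along the axis (Ramanujan's system; Zhou's
`d/dξ [P_ν(−ξ)/P_ν(ξ)] = −(2/π) sin(νπ)/((1−ξ²)P_ν(ξ)²)` read backwards). [cite: DhokerKaidi2024, (8.2.7)] -/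
theorem hasDerivAt_axisXi {t : ℝ} (ht : 0 < t) :
    HasDerivAt axisXi (π * e₄ t ^ (1 / 2 : ℝ) * axisT t) t := by
  have h4 := hasDerivAt_e₄ ht
  have h6 := hasDerivAt_e₆ ht
  have hpos := e₄_pos ht
  have h := h6.mul (h4.rpow_const (p := -(3 / 2 : ℝ)) (Or.inl hpos.ne'))
  refine (h.congr_of_eventuallyEq (Eventually.of_forall fun s => rfl)).congr_deriv ?_
  -- express all powers through `u = e₄^{1/2}`
  have hu : e₄ t ^ (1 / 2 : ℝ) * e₄ t ^ (1 / 2 : ℝ) = e₄ t := by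
    rw [← Real.rpow_add hpos]; norm_num
  have h32 : e₄ t ^ (-(3 / 2 : ℝ)) = (e₄ t ^ (1 / 2 : ℝ))⁻¹ * (e₄ t)⁻¹ := by
    rw [show (-(3 / 2 : ℝ)) = -(1 / 2) + (-1) by norm_num, Real.rpow_add hpos, Real.rpow_neg hpos.le,
      Real.rpow_neg_one]
  have h52 : e₄ t ^ (-(3 / 2 : ℝ) - 1) = (e₄ t ^ (1 / 2 : ℝ))⁻¹ * (e₄ t)⁻¹ * (e₄ t)⁻¹ := by
    rw [show (-(3 / 2 : ℝ) - 1) = -(1 / 2) + (-1) + (-1) by norm_num, Real.rpow_add hpos,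
      Real.rpow_add hpos, Real.rpow_neg hpos.le, Real.rpow_neg_one]
  have hune : e₄ t ^ (1 / 2 : ℝ) ≠ 0 := (Real.rpow_pos_of_pos hpos _).ne'
  rw [h32, h52, axisT]
  set u := e₄ t ^ (1 / 2 : ℝ) with hudef
  rw [← hu]
  field_simp
  ring

/-- `T = 1 − ξ²`. [folklore] -/
theorem axisT_eq {t : ℝ} (ht : 0 < t) : axisT t = 1 - axisXi t ^ 2 := by
  rw [axisXi_sq ht]; ring

/-- **`√E₄(it) = P_{−1/6}(ξ(t))²`** for `t > 1`: Fricke–Klein (`E₄^{1/4} = ₂F₁(1/12,5/12;1;T)`,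
`axisPhi_eq_axisE4Root`) and Gauss's quadratic transformation (`P_{−1/6}(ξ) = ₂F₁(1/12,5/12;1;1−ξ²)`,
`legendreP_eq_quadP`) — Zhou's `[P_{−1/6}(√((j−1728)/j))]¹² = Δj = E₄³` on the axis. [cite: Zhou2015, Remark 9 and eq. (P_sixth_eta), (z_Pnu_ratios) (arXiv pp. 17–19)] -/
theorem sqrt_e₄_eq_legendreP_sq {t : ℝ} (ht : 1 < t) :
    e₄ t ^ (1 / 2 : ℝ) = legendreP (-1 / 6) (axisXi t) ^ 2 := by
  have ht0 := zero_lt_one.trans ht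
  have hΦ := axisPhi_eq_axisE4Root ht
  have hK := legendreP_eq_quadP (ν := -1 / 6) (by norm_num) (by norm_num) (axisXi_pos ht)
    (axisXi_lt_one ht).le
  rw [← axisT_eq ht0, show (-(-1 / 6 : ℝ)) / 2 = 1 / 12 by norm_num,
    show ((-1 / 6 : ℝ) + 1) / 2 = 5 / 12 by norm_num] at hK
  -- `axisPhi t = ₂F₁(1/12,5/12;1;T)`, `axisE4Root t = e₄^{1/4}`
  have h1 : legendreP (-1 / 6) (axisXi t) = axisE4Root t := by
    rw [hK, ← hΦ, axisPhi]
  rw [h1, axisE4Root, ← Real.rpow_natCast, ← Real.rpow_mul (e₄_pos ht0).le]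
  norm_num

/-- The integrand in the new variable: `Δ(it)/E₄(it)² = (e₄³ − e₆²)/(1728e₄²) = P_{−1/6}(ξ(t))²·ξ'(t)/(1728π)`.
[folklore] -/
theorem deltaOverE4Sq_axis_eq {t : ℝ} (ht : 1 < t) :
    (e₄ t ^ 3 - e₆ t ^ 2) / (1728 * e₄ t ^ 2) =
      legendreP (-1 / 6) (axisXi t) ^ 2 * (π * e₄ t ^ (1 / 2 : ℝ) * axisT t) / (1728 * π) := by
  have ht0 := zero_lt_one.trans ht
  have hpos := e₄_pos ht0
  rw [← sqrt_e₄_eq_legendreP_sq ht]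
  have hu : e₄ t ^ (1 / 2 : ℝ) * e₄ t ^ (1 / 2 : ℝ) = e₄ t := by
    rw [← Real.rpow_add hpos]; norm_num
  have hune : e₄ t ^ (1 / 2 : ℝ) ≠ 0 := (Real.rpow_pos_of_pos hpos _).ne'
  have hπ : (π : ℝ) ≠ 0 := Real.pi_ne_zero
  rw [axisT]
  set u := e₄ t ^ (1 / 2 : ℝ) with hudef
  rw [← hu]
  field_simp

/-- `ξ` is continuous at every `t > 0`. [folklore] -/
theorem continuousAt_axisXi {t : ℝ} (ht : 0 < t) : ContinuousAt axisXi t :=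
  (hasDerivAt_axisXi ht).continuousAt

/-- `ξ` is strictly increasing on `[1, ∞)` (`ξ' > 0` on `(1, ∞)`). [folklore] -/
theorem strictMonoOn_axisXi : StrictMonoOn axisXi (Set.Ici 1) := by
  refine strictMonoOn_of_deriv_pos (convex_Ici 1)
    (fun t ht => (continuousAt_axisXi (zero_lt_one.trans_le ht)).continuousWithinAt) fun t ht => ?_
  rw [interior_Ici] at ht
  rw [(hasDerivAt_axisXi (zero_lt_one.trans ht)).deriv]
  exact mul_pos (mul_pos Real.pi_pos (Real.rpow_pos_of_pos (e₄_pos (zero_lt_one.trans ht)) _))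
    (axisT_pos ht)

/-- `ξ(t) → 1` as `t → ∞`. [folklore] -/
theorem tendsto_axisXi_atTop : Tendsto axisXi atTop (𝓝 1) := by
  have h : Tendsto (fun t => e₆ t * e₄ t ^ (-(3 / 2 : ℝ))) atTop (𝓝 (1 * 1 ^ (-(3 / 2 : ℝ)))) :=
    tendsto_e₆_atTop.mul (tendsto_e₄_atTop.rpow_const (Or.inl one_ne_zero))
  rw [Real.one_rpow, mul_one] at h
  exact h

/-- `ξ` maps `(1, ∞)` onto `(0, 1)`. [folklore] -/
theorem image_axisXi_Ioi : axisXi '' Set.Ioi 1 = Set.Ioo 0 1 := by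
  apply Set.Subset.antisymm
  · rintro y ⟨t, ht, rfl⟩
    exact ⟨axisXi_pos ht, axisXi_lt_one ht⟩
  · intro y hy
    -- a point `T₀ > 1` with `ξ(T₀) > y`
    obtain ⟨T₀, hT₀⟩ := (Filter.eventually_atTop.mp
      ((tendsto_axisXi_atTop.eventually (lt_mem_nhds hy.2)).and (eventually_gt_atTop 1)))
    have hT₀' := hT₀ T₀ le_rfl
    have hcont : ContinuousOn axisXi (Set.Icc 1 T₀) := fun t ht =>
      (continuousAt_axisXi (zero_lt_one.trans_le ht.1)).continuousWithinAt
    have hmem : y ∈ Set.Icc (axisXi 1) (axisXi T₀) := by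
      rw [axisXi_one]; exact ⟨hy.1.le, hT₀'.1.le⟩
    obtain ⟨t, ht, hty⟩ := intermediate_value_Icc hT₀'.2.le hcont hmem
    have ht1 : t ≠ 1 := by
      rintro rfl
      rw [axisXi_one] at hty
      exact absurd hty hy.1.ne
    exact ⟨t, lt_of_le_of_ne ht.1 (Ne.symm ht1), hty⟩

/-- **`∫₁^∞ Δ(it)/E₄(it)² dt = (1728π)⁻¹ ∫₀¹ P_{−1/6}(ξ)² dξ`** (real form, `Δ/E₄² = (e₄³−e₆²)/(1728e₄²)`):
the change of variables `ξ = E₆/E₄^{3/2}` (`integral_image_eq_integral_abs_deriv_smul`), the level-one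
instance of the mechanism behind Zhou 2015, Remark 9 (`G₂` as `∫₀¹P_ν²`). [cite: Zhou2015, Remark 9 and eq. (P_sixth_eta), (z_Pnu_ratios) (arXiv pp. 17–19)] -/
theorem integral_deltaOverE4Sq_axis :
    ∫ t in Set.Ioi (1 : ℝ), (e₄ t ^ 3 - e₆ t ^ 2) / (1728 * e₄ t ^ 2) =
      (1728 * π)⁻¹ * ∫ ξ in (0 : ℝ)..1, legendreP (-1 / 6) ξ ^ 2 := by
  have himage := integral_image_eq_integral_abs_deriv_smul (f := axisXi)
    (f' := fun t => π * e₄ t ^ (1 / 2 : ℝ) * axisT t) measurableSet_Ioi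
    (fun t ht => (hasDerivAt_axisXi (zero_lt_one.trans ht)).hasDerivWithinAt)
    (strictMonoOn_axisXi.injOn.mono Set.Ioi_subset_Ici_self)
    (fun ξ => legendreP (-1 / 6) ξ ^ 2)
  rw [image_axisXi_Ioi] at himage
  rw [intervalIntegral.integral_of_le zero_le_one, integral_Ioc_eq_integral_Ioo, himage,
    ← integral_const_mul]
  refine setIntegral_congr_fun measurableSet_Ioi fun t ht => ?_
  have ht' : (1 : ℝ) < t := ht
  have habs : |π * e₄ t ^ (1 / 2 : ℝ) * axisT t| = π * e₄ t ^ (1 / 2 : ℝ) * axisT t :=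
    abs_of_pos (mul_pos (mul_pos Real.pi_pos (Real.rpow_pos_of_pos (e₄_pos (zero_lt_one.trans ht')) _))
      (axisT_pos ht'))
  rw [deltaOverE4Sq_axis_eq ht', habs, smul_eq_mul]
  field_simp

/-- The value: `∫₁^∞ Δ(it)/E₄(it)² dt = (1728π)⁻¹ · (3√3/(2π)) log(2+√3)` (with the tree's
`∫₀¹ P_{−1/6}² = (3√3/(2π)) log(2+√3)`, `integral_legendreP_neg_one_sixth_sq`). [cite: Zhou2015, Remark 9 and eq. (P_sixth_eta), (z_Pnu_ratios) (arXiv pp. 17–19)] -/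
theorem integral_deltaOverE4Sq_axis_eq_log :
    ∫ t in Set.Ioi (1 : ℝ), (e₄ t ^ 3 - e₆ t ^ 2) / (1728 * e₄ t ^ 2) =
      (1728 * π)⁻¹ * (3 * Real.sqrt 3 / (2 * π) * Real.log (2 + Real.sqrt 3)) := by
  rw [integral_deltaOverE4Sq_axis, integral_legendreP_neg_one_sixth_sq]

/-- On the axis `Δ(it)/E₄(it)² = (e₄³ − e₆²)/(1728 e₄²)` (`Δ = (E₄³ − E₆²)/1728`), a real number. [folklore] -/
theorem discriminant_div_E₄_sq_axisPt {t : ℝ} (ht : 0 < t) :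
    ModularForm.discriminant (axisPt t) / E₄ (axisPt t) ^ 2 =
      (((e₄ t ^ 3 - e₆ t ^ 2) / (1728 * e₄ t ^ 2) : ℝ) : ℂ) := by
  rw [ModularForm.discriminant_eq_E₄_cube_sub_E₆_sq, E₄_axisPt ht, E₆_axisPt ht]
  push_cast
  ring

/-- **`∫₁^∞ Δ(it)/E₄(it)² dt = (1728π)⁻¹ ∫₀¹ P_{−1/6}(ξ)² dξ`**, complex form (Mathlib's `ModularForm.discriminant`, `E₄`).
[cite: Zhou2015, Remark 9 and eq. (P_sixth_eta), (z_Pnu_ratios) (arXiv pp. 17–19)] -/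
theorem integral_discriminant_div_E₄_sq_axis :
    ∫ t in Set.Ioi (1 : ℝ), ModularForm.discriminant (axisPt t) / E₄ (axisPt t) ^ 2 =
      (((1728 * π)⁻¹ * ∫ ξ in (0 : ℝ)..1, legendreP (-1 / 6) ξ ^ 2 : ℝ) : ℂ) := by
  rw [← integral_deltaOverE4Sq_axis, ← integral_complex_ofReal]
  exact setIntegral_congr_fun measurableSet_Ioi fun t ht =>
    discriminant_div_E₄_sq_axisPt (zero_lt_one.trans ht)

end Literature.NumberTheory.ModularForms

end
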